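import Mathlib.Topology.Order.Basic
import Mathlib.Topology.Algebra.Order.Field
import Mathlib.Order.Filter.AtTopBot.Basic
import Mathlib.Data.Finset.Lattice.Fold
import Mathlib.Analysis.SpecificLimits.Basic

/-!
# Route EIHFluxBalance — `InertialRecession`, re-charting: STEP PROFILES (eventually-for-each-stage
# ⇒ on a growing profile)

Helper file for the crux `stmt-FinalStateConjecture-10166`
(`Summit.FinalStateConjecture.FinalStateConjecture.Theses.EIHFluxBalance.InertialRecession`),
stub `stub_rechart` (the transfer P2 of line `sublinear-is-free-clean-window-charges`).

The clock-chart package and the time-raising lemma deliver their clauses in the form "for every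
bound `K` there is a time after which the property holds on `{‖ỹ‖ ≤ K}`", while the transfer needs
them on a GROWING profile `{‖ỹ‖ ≤ R(t)}`, `R` monotone, `R → ∞`. `exists_step_profile`: if for every
stage `n : ℕ` the property `Q n t` holds for all late `t`, there is a monotone step profile
`R : ℝ → ℕ` with `R → ∞` and `Q (R t) t` for all late `t`; `exists_step_profile_le` adds a cap
`R ≤ cap` for any cap `→ ∞` (with `Q` antitone in the stage). [folklore real analysis]
-/

noncomputable section

set_option linter.dupNamespace false

open Set Filter Topology

namespace Summit.FinalStateConjecture.FinalStateConjecture.Theorems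

/-- **Step profile.** If every stage `n` holds eventually (`∀ n, ∃ T, ∀ t ≥ T, Q n t`), there is a
monotone `R : ℝ → ℕ` tending to `∞` with `Q (R t) t` for all `t ≥ T`. [folklore] -/
theorem exists_step_profile {Q : ℕ → ℝ → Prop} (h : ∀ n : ℕ, ∃ T : ℝ, ∀ t, T ≤ t → Q n t) :
    ∃ R : ℝ → ℕ, Monotone R ∧ Tendsto (fun t ↦ (R t : ℝ)) atTop atTop ∧
      ∃ T : ℝ, ∀ t, T ≤ t → Q (R t) t := by
  classical
  choose T hT using h
  -- monotone stage start times `S n ≥ n`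
  set S : ℕ → ℝ := fun n ↦ (Finset.range (n + 1)).sup' ⟨0, by simp⟩ (fun k ↦ |T k| + k) with hSdef
  have hSge : ∀ n k, k ≤ n → |T k| + k ≤ S n := fun n k hk ↦
    Finset.le_sup' (fun k ↦ |T k| + (k : ℝ)) (Finset.mem_range.mpr (Nat.lt_succ_of_le hk))
  have hSmono : Monotone S := fun m n hmn ↦
    Finset.sup'_le _ _ fun k hk ↦ hSge n k ((Nat.lt_succ_iff.mp (Finset.mem_range.mp hk)).trans hmn)
  have hSn : ∀ n : ℕ, (n : ℝ) ≤ S n := fun n ↦ by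
    have h := hSge n n le_rfl; linarith [abs_nonneg (T n)]
  -- the stage index of a time
  have hex : ∀ t : ℝ, ∃ n : ℕ, t < S (n + 1) := fun t ↦ by
    obtain ⟨n, hn⟩ := exists_nat_gt t
    exact ⟨n, hn.trans_le ((hSn (n + 1)).trans' (by push_cast; linarith))⟩
  set idx : ℝ → ℕ := fun t ↦ Nat.find (hex t) with hidx
  have hidx_spec : ∀ t, t < S (idx t + 1) := fun t ↦ Nat.find_spec (hex t)
  have hidx_min : ∀ t n, n < idx t → S (n + 1) ≤ t := fun t n hn ↦
    not_lt.mp (Nat.find_min (hex t) hn)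
  have hidx_mono : Monotone idx := by
    intro t t' htt'
    by_contra h
    push Not at h
    have h1 := hidx_min t (idx t') h
    have h2 := hidx_spec t'
    linarith
  have hidx_ge : ∀ t n, S n ≤ t → n ≤ idx t := by
    intro t n hn
    by_contra h
    push Not at h
    have h1 := hidx_spec t
    have h2 : S (idx t + 1) ≤ S n := hSmono h
    linarith
  refine ⟨idx, hidx_mono, ?_, ⟨S 0, fun t ht ↦ ?_⟩⟩
  · refine tendsto_atTop_atTop.mpr fun b ↦ ?_
    obtain ⟨n, hn⟩ := exists_nat_ge b
    exact ⟨S n, fun t ht ↦ hn.trans (by exact_mod_cast hidx_ge t n ht)⟩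
  · set n : ℕ := idx t with hn
    apply hT n t
    rcases Nat.eq_zero_or_pos n with hn0 | hnpos
    · have h1 := hSge 0 0 le_rfl
      rw [hn0]
      simp only [Nat.cast_zero, add_zero] at h1
      linarith [le_abs_self (T 0)]
    · have hSt : S n ≤ t := by
        have := hidx_min t (n - 1) (by omega)
        rwa [Nat.sub_add_cancel hnpos] at this
      have h1 := hSge n n le_rfl
      linarith [le_abs_self (T n), (Nat.cast_nonneg n : (0 : ℝ) ≤ n)]

/-- **Capped step profile.** As `exists_step_profile`, for properties antitone in the stage, with the
profile below a given cap `→ ∞`: a monotone `R : ℝ → ℕ`, `R → ∞`, `R t ≤ max (cap t) 0`, and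
`Q (R t) t` for late `t`. [folklore] -/
theorem exists_step_profile_le {Q : ℕ → ℝ → Prop} (h : ∀ n : ℕ, ∃ T : ℝ, ∀ t, T ≤ t → Q n t)
    (hanti : ∀ m n t, m ≤ n → Q n t → Q m t) (cap : ℝ → ℝ) (hcap : Monotone cap)
    (hcaptop : Tendsto cap atTop atTop) :
    ∃ R : ℝ → ℕ, Monotone R ∧ Tendsto (fun t ↦ (R t : ℝ)) atTop atTop ∧ (∀ t, (R t : ℝ) ≤ max (cap t) 0) ∧
      ∃ T : ℝ, ∀ t, T ≤ t → Q (R t) t := by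
  obtain ⟨R₀, hR₀m, hR₀top, T, hT⟩ := exists_step_profile h
  refine ⟨fun t ↦ min (R₀ t) ⌊max (cap t) 0⌋₊, fun t t' htt' ↦ ?_, ?_, fun t ↦ ?_, ⟨T, fun t ht ↦ ?_⟩⟩
  · exact min_le_min (hR₀m htt') (Nat.floor_le_floor (max_le_max (hcap htt') le_rfl))
  · refine tendsto_atTop_atTop.mpr fun b ↦ ?_
    obtain ⟨t₁, ht₁⟩ := eventually_atTop.1 (tendsto_atTop.1 hR₀top b)
    obtain ⟨t₂, ht₂⟩ := eventually_atTop.1 (tendsto_atTop.1 hcaptop (b + 1))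
    refine ⟨max t₁ t₂, fun t ht ↦ ?_⟩
    rw [Nat.cast_min]
    refine le_min (ht₁ t ((le_max_left _ _).trans ht)) ?_
    have h1 : b + 1 ≤ max (cap t) 0 := (ht₂ t ((le_max_right _ _).trans ht)).trans (le_max_left _ _)
    have h2 := Nat.lt_floor_add_one (max (cap t) 0)
    linarith
  · rw [Nat.cast_min]
    exact (min_le_right _ _).trans (Nat.floor_le (le_max_right _ _))
  · exact hanti _ _ _ (min_le_left _ _) (hT t ht)

/-- Registered one-line form (stub `step_profile_rechart` of the crux item) of
`exists_step_profile`. [folklore] -/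
theorem step_profile_rechart : open Filter in ∀ {Q : ℕ → ℝ → Prop}, (∀ n : ℕ, ∃ T : ℝ, ∀ t, T ≤ t → Q n t) → ∃ R : ℝ → ℕ, Monotone R ∧ Tendsto (fun t ↦ (R t : ℝ)) atTop atTop ∧ ∃ T : ℝ, ∀ t, T ≤ t → Q (R t) t :=
  fun h ↦ exists_step_profile h

end Summit.FinalStateConjecture.FinalStateConjecture.Theorems
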